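import Literature.Probability.LatticeModels.LatticeSineGordon
import Summits.QuantumFields.YangMills.Theses.SmallCircleAnchor

/-!
# Crux `AnchorGap` (stmt-QuantumFields-11141), line `registered` — soft layer under stub DS (`stub_debyeScreening`)

Stub DS of the skeleton `Cruxes/AnchorGap/Lines/birth.lean` (Debye screening of the multi-component
lattice sine-Gordon gas on the discrete three-torus, typed over
`Literature.Probability.LatticeModels.LatticeSineGordon`) is an expansion-sized statement; this
file records the closed, statement-independent facts about the functional `truncCorr` that every
version of DS (and its `A₂` sibling in `QCD/SmallCircleGap`) consumes:

* `truncCorr_abs_le_two` — for `g ≠ 0`, `ε > 0` and measurable observables bounded by `1`, every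
  truncated correlation is at most `2` (so a clustering bound `C e^{-c n}` is free for `n ≤ n₀`
  with `C ≥ 2 e^{c n₀}`);
* `weight_translate`, `integral_comp_translate`, `expect_translate`, `truncCorr_translate` — the
  Boltzmann weight, the Lebesgue integral on configurations, the expectation and the truncated
  correlation are invariant under lattice translations `φ ↦ φ (· + v, ·)` of the torus (reindexing
  of finite sums; `volume` on the finite product is permutation invariant);
* `measurable_comp_translate`, `obs_translate` — the admissibility predicate `Obs` of DS (measurable,
  bounded by `1`, local in the cube at `c₀` of side `R₀`, invariant under sitewise dual-lattice
  shifts) is carried by translation from base point `c₀` to base point `c₀ + v`; with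
  `truncCorr_translate` this puts the base point of DS at `0` without loss.
-/

set_option autoImplicit false

noncomputable section

namespace Summit.QuantumFields.YangMills.Theorems.AnchorGap

open MeasureTheory
open Literature.Probability.LatticeModels

/-- **Truncated correlations of bounded observables are at most `2`.** For `g ≠ 0`, `ε > 0`,
and measurable `F, G` with `|F|, |G| ≤ 1`:
`|truncCorr F G| = |⟨FG⟩ − ⟨F⟩⟨G⟩| ≤ 1 + 1·1 = 2` (`LatticeSineGordon.abs_expect_le`). [folklore] -/
theorem truncCorr_abs_le_two :
    ∀ (d N k : ℕ) [NeZero N] (ι : Type) [Fintype ι] (α : ι → Fin k → ℝ) (g ε ζ : ℝ), g ≠ 0 → 0 < ε → ∀ F G : LatticeSineGordon.Config d N k → ℝ, Measurable F → Measurable G → (∀ φ, |F φ| ≤ 1) → (∀ φ, |G φ| ≤ 1) → |LatticeSineGordon.truncCorr α g ε ζ F G| ≤ 2 := by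
  intro d N k _ ι _ α g ε ζ hg hε F G hF hG hF1 hG1
  have hFG : ∀ φ, |F φ * G φ| ≤ 1 := fun φ => by
    rw [abs_mul]
    calc |F φ| * |G φ| ≤ 1 * 1 := mul_le_mul (hF1 φ) (hG1 φ) (abs_nonneg _) zero_le_one
      _ = 1 := one_mul 1
  have h1 := LatticeSineGordon.abs_expect_le (d := d) (N := N) α hg hε ζ
    (hF.mul hG).aestronglyMeasurable hFG
  have h2 := LatticeSineGordon.abs_expect_le (d := d) (N := N) α hg hε ζ hF.aestronglyMeasurable hF1
  have h3 := LatticeSineGordon.abs_expect_le (d := d) (N := N) α hg hε ζ hG.aestronglyMeasurable hG1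
  unfold LatticeSineGordon.truncCorr
  calc _ ≤ |LatticeSineGordon.expect α g ε ζ (fun φ => F φ * G φ)| +
        |LatticeSineGordon.expect α g ε ζ F * LatticeSineGordon.expect α g ε ζ G| := abs_sub _ _
    _ ≤ 1 + 1 * 1 := by
        rw [abs_mul]
        exact add_le_add h1 (mul_le_mul h2 h3 (abs_nonneg _) zero_le_one)
    _ = 2 := by norm_num

/-- **The Boltzmann weight is translation invariant**: relabelling the sites `x ↦ x + v` of the
torus leaves the gradient term, the mass term and the tilt unchanged (finite sums reindexed by the
bijection `x ↦ x + v`, using `(x + v) + eᵢ = (x + eᵢ) + v`). [folklore] -/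
theorem weight_translate :
    ∀ (d N k : ℕ) [NeZero N] (ι : Type) [Fintype ι] (α : ι → Fin k → ℝ) (g ε ζ : ℝ) (v : TorusSite d N) (φ : LatticeSineGordon.Config d N k), LatticeSineGordon.weight α g ε ζ (fun p => φ (p.1 + v, p.2)) = LatticeSineGordon.weight α g ε ζ φ := by
  intro d N k _ ι _ α g ε ζ v φ
  have hS : LatticeSineGordon.gaussianAction g ε (fun p : TorusSite d N × Fin k => φ (p.1 + v, p.2)) =
      LatticeSineGordon.gaussianAction g ε φ := by
    unfold LatticeSineGordon.gaussianAction
    congr 2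
    · refine Fintype.sum_equiv (Equiv.addRight v) _ _ fun x => ?_
      refine Finset.sum_congr rfl fun i _ => Finset.sum_congr rfl fun a _ => ?_
      simp only [Equiv.coe_addRight, add_right_comm x _ v]
    · congr 1
      exact Fintype.sum_equiv ((Equiv.addRight v).prodCongr (Equiv.refl (Fin k))) _ _ fun p => rfl
  have hT : LatticeSineGordon.tilt α ζ (fun p : TorusSite d N × Fin k => φ (p.1 + v, p.2)) =
      LatticeSineGordon.tilt α ζ φ := by
    unfold LatticeSineGordon.tilt LatticeSineGordon.pairing
    congr 1
    exact Fintype.sum_equiv (Equiv.addRight v) _ _ fun x => rfl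
  unfold LatticeSineGordon.weight
  rw [hS, hT]

/-- **Lebesgue measure on configurations is translation invariant**: for every `H`,
`∫ H (φ (· + v, ·)) dφ = ∫ H φ dφ` — the translation is the coordinate permutation
`MeasurableEquiv.piCongrLeft` along `p ↦ (p.1 + v, p.2)`, which preserves `volume`
(`volume_measurePreserving_piCongrLeft`); no integrability is needed (`integral_comp'`). [folklore] -/
theorem integral_comp_translate :
    ∀ (d N k : ℕ) [NeZero N] (v : TorusSite d N) (H : LatticeSineGordon.Config d N k → ℝ), ∫ φ : LatticeSineGordon.Config d N k, H (fun p => φ (p.1 + v, p.2)) = ∫ φ : LatticeSineGordon.Config d N k, H φ := by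
  intro d N k _ v H
  set e : TorusSite d N × Fin k ≃ TorusSite d N × Fin k :=
    (Equiv.addRight v).prodCongr (Equiv.refl (Fin k)) with he
  have hmp := ((volume_measurePreserving_piCongrLeft (fun _ : TorusSite d N × Fin k => ℝ) e).symm _)
  have key := hmp.integral_comp' (g := H)
  have hcoe : ∀ φ : LatticeSineGordon.Config d N k,
      (MeasurableEquiv.piCongrLeft (fun _ : TorusSite d N × Fin k => ℝ) e).symm φ =
        fun p => φ (p.1 + v, p.2) := by
    intro φ
    funext p
    rfl
  simpa only [hcoe] using key

/-- **Expectations are translation invariant**: `⟨F (φ (· + v, ·))⟩ = ⟨F⟩` (the weight is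
invariant, `weight_translate`, and Lebesgue measure is, `integral_comp_translate`). [folklore] -/
theorem expect_translate :
    ∀ (d N k : ℕ) [NeZero N] (ι : Type) [Fintype ι] (α : ι → Fin k → ℝ) (g ε ζ : ℝ) (v : TorusSite d N) (F : LatticeSineGordon.Config d N k → ℝ), LatticeSineGordon.expect α g ε ζ (fun φ => F (fun p => φ (p.1 + v, p.2))) = LatticeSineGordon.expect α g ε ζ F := by
  intro d N k _ ι _ α g ε ζ v F
  unfold LatticeSineGordon.expect
  congr 1
  calc ∫ φ : LatticeSineGordon.Config d N k, F (fun p => φ (p.1 + v, p.2)) * LatticeSineGordon.weight α g ε ζ φ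
      = ∫ φ : LatticeSineGordon.Config d N k, F (fun p => φ (p.1 + v, p.2)) *
          LatticeSineGordon.weight α g ε ζ (fun p => φ (p.1 + v, p.2)) := by
        simp_rw [weight_translate]
    _ = ∫ φ : LatticeSineGordon.Config d N k, F φ * LatticeSineGordon.weight α g ε ζ φ :=
        integral_comp_translate d N k v (fun ψ => F ψ * LatticeSineGordon.weight α g ε ζ ψ)

/-- **Truncated correlations are translation invariant**: translating both observables by the
same `v` does not change `⟨FG⟩ − ⟨F⟩⟨G⟩`. [folklore] -/
theorem truncCorr_translate :
    ∀ (d N k : ℕ) [NeZero N] (ι : Type) [Fintype ι] (α : ι → Fin k → ℝ) (g ε ζ : ℝ) (v : TorusSite d N) (F G : LatticeSineGordon.Config d N k → ℝ), LatticeSineGordon.truncCorr α g ε ζ (fun φ => F (fun p => φ (p.1 + v, p.2))) (fun φ => G (fun p => φ (p.1 + v, p.2))) = LatticeSineGordon.truncCorr α g ε ζ F G := by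
  intro d N k _ ι _ α g ε ζ v F G
  unfold LatticeSineGordon.truncCorr
  rw [expect_translate d N k ι α g ε ζ v F, expect_translate d N k ι α g ε ζ v G,
    expect_translate d N k ι α g ε ζ v (fun ψ => F ψ * G ψ)]

/-- **Translates of measurable observables are measurable** (the translation is a measurable
self-map of the finite product). [folklore] -/
theorem measurable_comp_translate :
    ∀ (d N k : ℕ) [NeZero N] (v : TorusSite d N) (F : LatticeSineGordon.Config d N k → ℝ), Measurable F → Measurable fun φ : LatticeSineGordon.Config d N k => F (fun p => φ (p.1 + v, p.2)) := by
  intro d N k _ v F hF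
  exact hF.comp (measurable_pi_lambda _ fun p => measurable_pi_apply _)

/-- **Admissible observables translate**: if `G` is admissible at base point `c₀` (measurable,
`|G| ≤ 1`, depends only on the field in the cube `{x | ∀ i, (x i − c₀ i).val ≤ R₀}`, invariant
under sitewise shifts of the field by vectors `w` of the lattice dual to the charges `α`), then
`φ ↦ G (φ (· + v, ·))` is admissible at base point `c₀ + v` (locality: `y − (c₀ + v) = (y − v) − c₀`;
periodicity: translating a shift at site `x` gives the shift at site `x − v` of the translate).
[folklore] -/
theorem obs_translate :
    ∀ (d N k M R₀ : ℕ) [NeZero N] (α : Fin M → Fin k → ℝ) (c₀ v : TorusSite d N) (G : LatticeSineGordon.Config d N k → ℝ), let Obs := fun (c : TorusSite d N) (F : LatticeSineGordon.Config d N k → ℝ) => Measurable F ∧ (∀ φ, |F φ| ≤ 1) ∧ (∀ φ ψ : LatticeSineGordon.Config d N k, (∀ x : TorusSite d N, (∀ i : Fin d, (x i - c i).val ≤ R₀) → ∀ a : Fin k, φ (x, a) = ψ (x, a)) → F φ = F ψ) ∧ (∀ (φ : LatticeSineGordon.Config d N k) (x : TorusSite d N) (w : Fin k → ℝ), (∀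 r : Fin M, ∃ z : ℤ, ∑ a : Fin k, α r a * w a = 2 * Real.pi * z) → F (fun p => if p.1 = x then φ p + w p.2 else φ p) = F φ); Obs c₀ G → Obs (c₀ + v) (fun φ => G (fun p => φ (p.1 + v, p.2))) := by
  intro d N k M R₀ _ α c₀ v G Obs hG
  obtain ⟨hGm, hG1, hGloc, hGper⟩ := hG
  refine ⟨measurable_comp_translate d N k v G hGm, fun φ => hG1 _, ?_, ?_⟩
  · intro φ ψ h
    refine hGloc _ _ fun x hx a => h (x + v) (fun i => ?_) a
    have : (x + v) i - (c₀ + v) i = x i - c₀ i := by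
      simp only [Pi.add_apply]; abel
    rw [this]
    exact hx i
  · intro φ x w hw
    have key : (fun p : TorusSite d N × Fin k =>
        (fun q : TorusSite d N × Fin k => if q.1 = x then φ q + w q.2 else φ q) (p.1 + v, p.2)) =
        fun p => if p.1 = x - v then φ (p.1 + v, p.2) + w p.2 else φ (p.1 + v, p.2) := by
      funext p
      show (if (p.1 + v, p.2).1 = x then φ (p.1 + v, p.2) + w (p.1 + v, p.2).2 else φ (p.1 + v, p.2)) =
        if p.1 = x - v then φ (p.1 + v, p.2) + w p.2 else φ (p.1 + v, p.2)
      by_cases h : p.1 = x - v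
      · have h' : (p.1 + v, p.2).1 = x := by
          show p.1 + v = x
          rw [h]; exact sub_add_cancel x v
        rw [if_pos h', if_pos h]
      · have h' : ¬ (p.1 + v, p.2).1 = x := fun h'' => h (by
          show p.1 = x - v
          rw [← h'']; exact (add_sub_cancel_right p.1 v).symm)
        rw [if_neg h', if_neg h]
    calc (fun φ => G fun p => φ (p.1 + v, p.2)) (fun p => if p.1 = x then φ p + w p.2 else φ p)
        = G (fun p => if p.1 = x - v then φ (p.1 + v, p.2) + w p.2 else φ (p.1 + v, p.2)) :=
          congrArg G key
      _ = G (fun q => φ (q.1 + v, q.2)) := hGper (fun q => φ (q.1 + v, q.2)) (x - v) w hw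

end Summit.QuantumFields.YangMills.Theorems.AnchorGap

end
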